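import Summits.FinalStateConjecture.FinalStateConjecture.Theorems.ExactKerrEndsTameEscapeToKerrEndsChartKerrEnd
import Literature.Geometry.Lorentzian.CauchyDevelopmentComap
import Literature.Geometry.Lorentzian.CauchyDevelopmentRestrict
import Literature.Geometry.Lorentzian.DataEmbeddingNormalSmooth
import Literature.Geometry.Lorentzian.CausalityAchronalProofs
import Literature.Geometry.Lorentzian.MinkowskiCauchy
import Literature.Geometry.Lorentzian.AFEndRestrict
import HarnessLib

/-!
# Route `ExactKerrEnds`, crux `TameEscapeToKerrEnds` (stmt-FinalStateConjecture-18522), line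
# `matched-kerr-solution-map`: Minkowski Cauchy data are Kerr-ended (the `M = 0` leaf of stub S2)

Geometric core of stub S2 `NonposMassKerrEnded` of the registered skeleton
`Cruxes/TameEscapeToKerrEnds/Lines/matched_kerr_solution_map.lean` (the rigidity branch `M = 0`):
a datum `D` on `X` admitting a Cauchy development WHICH IS Minkowski space
(`𝒟.toSpacetime = Minkowski.spacetime`, the conclusion of the named fact
`positive_mass_rigidity_spacetime`, Beig–Chruściel 1996, Thm. 4.1), on a manifold with a sole end
structure `e`, has an exact Kerr end (`InitialDataSet.HasExactKerrEnd`) with parameters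
`M = a = 0`: Minkowski space off the time axis IS the `M = 0` Kerr–Schild chart
(`Kerr.bilin 0 a = η`, `Kerr.region 0 0 = {x | x̲ ≠ 0}`, time orientation `∂ₜ`), the time axis
(an endless timelike curve) meets the Cauchy hypersurface `ι(X)` in exactly one point `ι(x₀)`,
and beyond the chart radius `ρ := max R ‖coord x₀‖` the leaf `ι ∘ Φₑ` exhibits `D` as an exact
spacelike Kerr leaf (`hasExactKerrEnd_of_chartExactKerrBeyond`, the landed stub S3a); the metric
and `k` clauses are the chain rule and the naturality of the second fundamental form under
reparametrisation (`secondFundamentalForm_comp_right`) and under restriction of the ambient space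
(`secondFundamentalForm_comap`, `kerrSmoothMetric_zero_eq_comap`).

Main results: `hasExactKerrEnd_of_minkowski_embedding` (unbundled form) and
`hasExactKerrEnd_of_cauchyDevelopment_eq_minkowski`. The assembly of S2 from the positive mass
theorem is `ExactKerrEndsTameEscapeToKerrEndsNonposMass.lean`.
-/

set_option linter.dupNamespace false

noncomputable section

namespace Summit.FinalStateConjecture.FinalStateConjecture.Theorems.ExactKerrEnds

open scoped Manifold ContDiff Topology
open Set Filter Function TopologicalSpace Bundle Literature.Geometry.Lorentzian

-- Below, the metric and time orientation of `Minkowski.spacetime` (its fields, by `rfl`) are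
-- written `Minkowski.metric.ofLE le_top` / `Minkowski.timeOrientation.ofLE le_top`, with carrier
-- syntactically `E4` (pattern of `MinkowskiGlobalHyperbolicity.lean`), so that the instances of
-- `E4` apply.

/-! ### The `M = 0` Kerr–Schild chart is Minkowski space off the time axis -/

/-- For `M = 0` the Kerr time-orientation field `V = −g♯dt* = ∂_{t*} − 2Hℓ` is `∂_{t*}`
(`H = 0`).
Dafermos–Rodnianski arXiv:0811.0354, §5.1. [folklore] -/
theorem kerr_timeVector_zero_mass (a : ℝ) (x : E4) : Kerr.timeVector 0 a x = E4.basisVector 0 := by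
  simp [Kerr.timeVector, Kerr.scalarH]

/-- A point with nonzero spatial part lies in the `a = 0` Kerr–Schild chart region of every floor
`r₀ ≤ 0` (`r = ‖x̲‖ > 0 = max r₀ 0`). [folklore] -/
theorem mem_kerrRegion_zero_of_spatial_ne_zero {p : E4} (hp : E4.spatial p ≠ 0) :
    p ∈ Kerr.region (0 : ℝ) 0 := by
  rw [Kerr.mem_region, max_self, Kerr.radius_zero_left]
  exact norm_pos_iff.mpr hp

/-- **The `M = 0` Kerr–Schild metric is the restriction of the Minkowski metric**: as
pseudo-Riemannian metrics on the chart region, `g_{0,a} = (Subtype.val)^* η`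
(`Kerr.bilin_zero_left`, `d(Subtype.val) = id`). [folklore] -/
theorem kerrSmoothMetric_zero_eq_comap [Kerr.Facts] (a r₀ : ℝ) :
    (Kerr.smoothMetric 0 a r₀).toPseudoRiemannianMetric =
      (Minkowski.metric.ofLE (n' := ∞) le_top).toPseudoRiemannianMetric.comap
        PseudoRiemannianMetric.contMDiff_pullbackBilin_holds (Subtype.val : Kerr.region a r₀ → E4)
        contMDiff_subtype_val
        (injective_mfderiv_subtypeVal (Kerr.region a r₀)) rfl := by
  refine PseudoRiemannianMetric.ext (funext fun x ↦ ?_)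
  ext v w
  change Kerr.bilin 0 a x.1 v w =
    Minkowski.bilin (mfderiv 𝓘(ℝ, E4) 𝓘(ℝ, E4) (Subtype.val : Kerr.region a r₀ → E4) x v)
      (mfderiv 𝓘(ℝ, E4) 𝓘(ℝ, E4) (Subtype.val : Kerr.region a r₀ → E4) x w)
  rw [mfderiv_subtypeVal, Kerr.bilin_zero_left]
  rfl

/-! ### The time axis of Minkowski space is an endless timelike curve -/

/-- **The time axis `t ↦ (t, 0)` is an endless timelike curve of Minkowski spacetime**: velocity
`∂ₜ` (unit future timelike), and the time coordinate is unbounded in both directions, so there is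
no endpoint. O'Neill 1983, Ch. 14, p. 409; Hawking–Ellis 1973, §6.2. [folklore] -/
theorem isEndlessTimelikeCurve_timeAxis :
    LorentzianMetric.IsEndlessTimelikeCurve (Minkowski.metric.ofLE (n' := ∞) le_top)
      (Minkowski.timeOrientation.ofLE (n' := ∞) le_top) (fun t : ℝ ↦ E4.ofTimeSpace t 0) univ := by
  have hγ : (fun t : ℝ ↦ E4.ofTimeSpace t 0) =
      fun t ↦ t • E4.basisVector 0 + E4.ofTimeSpace 0 0 :=
    funext fun t ↦ E4.ofTimeSpace_eq_smul_add t 0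
  have he0 : Minkowski.bilin (E4.basisVector 0) (E4.basisVector 0) < 0 := by
    rw [Minkowski.bilin_basisVector_zero]; norm_num
  have hne : (E4.basisVector 0 : E4) ≠ 0 := by
    intro h
    have := congrArg (fun v : E4 ↦ v 0) h
    simp at this
  refine ⟨ordConnected_univ, fun t _ ↦ ?_, ⟨univ_nonempty, fun p hp ↦ ?_⟩,
    ⟨univ_nonempty, fun p hp ↦ ?_⟩⟩
  · -- future timelike with velocity `(Minkowski.timeOrientation.ofLE (n' := ∞) le_top)`
    have hd : HasDerivAt (fun t : ℝ ↦ t • E4.basisVector 0 + E4.ofTimeSpace 0 0)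
        (E4.basisVector 0) t := by
      simpa using ((hasDerivAt_id t).smul_const (E4.basisVector 0)).add_const (E4.ofTimeSpace 0 0)
    rw [hγ]
    refine LorentzianMetric.futureTimelikeAt_of_hasMFDerivAt
      (g := Minkowski.metric.ofLE (n' := ∞) le_top) (τ := Minkowski.timeOrientation.ofLE (n' := ∞) le_top)
      rfl (hasMFDerivAt_iff_hasFDerivAt.mpr hd.hasFDerivAt) he0 ⟨⟨he0.le, hne⟩, he0⟩
  · -- no future endpoint: the time coordinate tends to `+∞`
    rw [hasFutureEndpoint_iff_tendsto_atTop (subset_univ (Ici 0))] at hp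
    have h1 : Tendsto (fun t : ℝ ↦ (E4.ofTimeSpace t 0) 0) atTop (𝓝 (p 0)) :=
      ((EuclideanSpace.proj (0 : Fin 4)).continuous.tendsto p).comp hp
    simp only [E4.ofTimeSpace_apply_zero] at h1
    exact not_tendsto_nhds_of_tendsto_atTop tendsto_id (p 0) h1
  · -- no past endpoint
    rw [hasPastEndpoint_iff_tendsto_atBot (subset_univ (Iic 0))] at hp
    have h1 : Tendsto (fun t : ℝ ↦ (E4.ofTimeSpace t 0) 0) atBot (𝓝 (p 0)) :=
      ((EuclideanSpace.proj (0 : Fin 4)).continuous.tendsto p).comp hp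
    simp only [E4.ofTimeSpace_apply_zero] at h1
    exact not_tendsto_nhds_of_tendsto_atBot tendsto_id (p 0) h1

/-- **A Cauchy hypersurface of Minkowski space meets the time axis in exactly one point**: if
`ι : X → ℝ⁴` is injective with `ι(X)` a Cauchy hypersurface of `(ℝ⁴, η, ∂ₜ)`, there is `x₀` such
that every `x` with `ι(x)` on the time axis (`ι(x)̲ = 0`) equals `x₀` (the endless timelike time
axis meets `ι(X)` exactly once). O'Neill 1983, Ch. 14, Def. 14.28. [folklore] -/
theorem exists_forall_spatial_eq_zero_imp_eq {X : Type*} (ι : X → E4) (hι : Injective ι)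
    (hC : LorentzianMetric.IsCauchyHypersurface (Minkowski.metric.ofLE (n' := ∞) le_top)
      (Minkowski.timeOrientation.ofLE (n' := ∞) le_top) (range ι)) :
    ∃ x₀ : X, ∀ x, E4.spatial (ι x) = 0 → x = x₀ := by
  obtain ⟨t₀, ⟨-, x₀, hx₀⟩, huniq⟩ := hC _ _ isEndlessTimelikeCurve_timeAxis
  refine ⟨x₀, fun x hx ↦ hι ?_⟩
  have h1 : ι x = E4.ofTimeSpace (ι x 0) 0 := by
    have h := E4.ofTimeSpace_time_spatial (ι x)
    rw [E4.time_apply, hx] at h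
    exact h.symm
  have h2 : ι x 0 = t₀ := huniq (ι x 0) ⟨mem_univ _, x, h1⟩
  rw [h1, h2, hx₀]

/-! ### A Minkowski leaf read in the `M = 0` Kerr chart along the end -/

/-- **A datum embedded as a spacelike hypersurface of Minkowski space meeting the time axis in at
most one point is Kerr-ended** (`M = a = 0`). Let `ι : X → ℝ⁴` be a smooth embedding with future
unit normal `ν` (differentiable along `ι`), `ι^* η = h`, `K_ν = k`, such that `ι(x)̲ = 0` only for
`x = x₀`, and let `e` be a sole end structure of `X`. With `ρ := max R ‖coord x₀‖` the chart
`Φₑ : {ρ < ‖y‖} → X` misses `x₀`, so the leaf `ψ := ι ∘ Φₑ` lands in the chart region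
`{x̲ ≠ 0} = Kerr.region 0 0` of the `M = 0` Kerr–Schild chart, whose metric is `η`
(`kerrSmoothMetric_zero_eq_comap`) and whose time orientation is `∂ₜ`
(`kerr_timeVector_zero_mass`); `ψ` is an injective spacelike immersion with future unit normal
`ν ∘ Φₑ`, and the chart components of `(h, k)` are the induced metric and the future second
fundamental form of `ψ` (chain rule; naturality of the second fundamental form under
reparametrisation, `secondFundamentalForm_comp_right`, and under restriction of the ambient space,
`secondFundamentalForm_comap`). Then `hasExactKerrEnd_of_chartExactKerrBeyond` (stub S3a).
[folklore] -/
theorem hasExactKerrEnd_of_minkowski_embedding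
    (X : Type) [TopologicalSpace X] [ChartedSpace E3 X] [IsManifold (𝓡 3) ∞ X] [T2Space X]
    [SecondCountableTopology X] [ConnectedSpace X] [Kerr.Facts]
    (D : InitialDataSet (𝓡 3) X) (e : AFEnd X) (hsole : e.IsSoleEnd)
    (ι : X → E4) (hι : Manifold.IsSmoothEmbedding (𝓡 3) 𝓘(ℝ, E4) ∞ ι)
    (ν : NormalField 𝓘(ℝ, E4) ι)
    (hν : LorentzianMetric.IsFutureUnitNormal (𝓡 3) (Minkowski.metric.ofLE (n' := ∞) le_top)
      (Minkowski.timeOrientation.ofLE (n' := ∞) le_top) ι ν)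
    (hh : ∀ y : X, pullbackBilin (I := 𝓘(ℝ, E4)) (I' := 𝓡 3) ι
      (Minkowski.metric.ofLE (n' := ∞) le_top).val y = D.h.inner y)
    (hk : ∀ [(Minkowski.metric.ofLE (n' := ∞) le_top).toPseudoRiemannianMetric.HasLeviCivita] (y : X),
      (Minkowski.metric.ofLE (n' := ∞) le_top).toPseudoRiemannianMetric.secondFundamentalForm
        (𝓡 3) ι ν y = D.kBilin y)
    (hνd : ∀ x : X, MDifferentiableAt (𝓡 3) 𝓘(ℝ, E4).tangent
      (fun x ↦ (TotalSpace.mk' E4 (ι x) (ν x) : TangentBundle 𝓘(ℝ, E4) E4)) x)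
    (x₀ : X) (haxis : ∀ x : X, E4.spatial (ι x) = 0 → x = x₀) :
    D.HasExactKerrEnd := by
  -- the chart radius: beyond `ρ` the chart of the end misses `x₀`
  set ρ : ℝ := max e.R ‖e.coord x₀‖ with hρ
  have hρR : e.R ≤ ρ := le_max_left _ _
  have hRval : ∀ y : exteriorRegion ρ, e.R < ‖(y : E3)‖ := fun y ↦ lt_of_le_of_lt hρR y.2
  -- the chart `φ := Φₑ ∘ val` of the end beyond `ρ`
  set φ : exteriorRegion ρ → X := fun y ↦ e.dataChartExt (y : E3) with hφ
  have hφs : ContMDiff 𝓘(ℝ, E3) (𝓡 3) ∞ φ :=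
    e.contMDiff_dataChartExt_comp contMDiff_subtype_val hRval
  have hφd : ∀ y, MDifferentiableAt 𝓘(ℝ, E3) (𝓡 3) φ y := fun y ↦
    (hφs y).mdifferentiableAt (by simp)
  have hderiv : ∀ y : exteriorRegion ρ, mfderiv 𝓘(ℝ, E3) (𝓡 3) φ y =
      mfderiv 𝓘(ℝ, E3) (𝓡 3) e.dataChartExt (y : E3) := fun y ↦
    mfderiv_comp_subtypeVal' e.dataChartExt y
  have hdφ_inj : ∀ (y : exteriorRegion ρ) (v : E3),
      mfderiv 𝓘(ℝ, E3) (𝓡 3) φ y v = 0 → v = 0 := by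
    intro y v hv
    have h1 := e.mfderiv_coord_mfderiv_dataChartExt (hRval y) v
    have h3 : mfderiv 𝓘(ℝ, E3) (𝓡 3) e.dataChartExt (y : E3) v = 0 :=
      (DFunLike.congr_fun (hderiv y) v).symm.trans hv
    rw [h3, map_zero] at h1
    exact h1.symm
  have hφne : ∀ y : exteriorRegion ρ, φ y ≠ x₀ := by
    intro y hy
    have h1 : e.coord (φ y) = y := e.coord_dataChartExt_of_lt (hRval y)
    rw [hy] at h1
    have h2 : ‖(y : E3)‖ ≤ ρ := by rw [← h1]; exact le_max_right _ _
    exact (lt_irrefl _) (lt_of_lt_of_le y.2 h2)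
  -- the leaf `ψ := ι ∘ φ`, landing in the `M = 0` chart region `{x̲ ≠ 0}`
  have hmem : ∀ y : exteriorRegion ρ, ι (φ y) ∈ Kerr.region (0 : ℝ) 0 := fun y ↦
    mem_kerrRegion_zero_of_spatial_ne_zero fun h ↦ hφne y (haxis _ h)
  set ψ : exteriorRegion ρ → Kerr.region (0 : ℝ) 0 := fun y ↦ ⟨ι (φ y), hmem y⟩ with hψ
  have hψval : Subtype.val ∘ ψ = ι ∘ φ := rfl
  -- smoothness and differentials
  have hιs : ContMDiff (𝓡 3) 𝓘(ℝ, E4) ∞ ι := hι.contMDiff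
  have hιd : ∀ x, MDifferentiableAt (𝓡 3) 𝓘(ℝ, E4) ι x := fun x ↦
    (hιs x).mdifferentiableAt (by simp)
  have hψ₀s : ContMDiff 𝓘(ℝ, E3) 𝓘(ℝ, E4) ∞ (ι ∘ φ) := hιs.comp hφs
  have hψs : ContMDiff 𝓘(ℝ, E3) 𝓘(ℝ, E4) ∞ ψ :=
    (ContMDiff.subtypeVal_comp_iff (Kerr.region (0 : ℝ) 0) ψ).1 hψ₀s
  have hψd : ∀ y, MDifferentiableAt 𝓘(ℝ, E3) 𝓘(ℝ, E4) ψ y := fun y ↦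
    (hψs y).mdifferentiableAt (by simp)
  have hdψ : ∀ (y : exteriorRegion ρ) (v : E3), mfderiv 𝓘(ℝ, E3) 𝓘(ℝ, E4) ψ y v =
      mfderiv (𝓡 3) 𝓘(ℝ, E4) ι (φ y) (mfderiv 𝓘(ℝ, E3) (𝓡 3) φ y v) := by
    intro y v
    have h1 := mfderiv_comp y
      (hasMFDerivAt_subtypeVal (I' := 𝓘(ℝ, E4)) (W := Kerr.region (0 : ℝ) 0)
        (ψ y)).mdifferentiableAt
      (hψd y)
    rw [hψval, mfderiv_subtypeVal, mfderiv_comp y (hιd (φ y)) (hφd y)] at h1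
    have h2 := DFunLike.congr_fun h1 v
    exact h2.symm
  -- the metric of the `M = 0` chart read on the leaf: `g_{0,0}(dψ v, dψ w) = h(dφ v, dφ w)`
  have hmetric : ∀ (y : exteriorRegion ρ) (v w : E3),
      Kerr.bilin 0 0 (ψ y : E4) (mfderiv 𝓘(ℝ, E3) 𝓘(ℝ, E4) ψ y v)
          (mfderiv 𝓘(ℝ, E3) 𝓘(ℝ, E4) ψ y w) =
        D.h.inner (φ y) (mfderiv 𝓘(ℝ, E3) (𝓡 3) φ y v) (mfderiv 𝓘(ℝ, E3) (𝓡 3) φ y w) := by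
    intro y v w
    rw [Kerr.bilin_zero_left, hdψ, hdψ, ← hh (φ y), pullbackBilin_apply]
    rfl
  -- (i) injectivity of the leaf
  have hψinj : Injective ψ := by
    intro y₁ y₂ h
    have h1 : ι (φ y₁) = ι (φ y₂) := congrArg Subtype.val h
    have h2 : φ y₁ = φ y₂ := hι.isEmbedding.injective h1
    have h3 : e.coord (φ y₁) = e.coord (φ y₂) := congrArg e.coord h2
    rw [e.coord_dataChartExt_of_lt (hRval y₁), e.coord_dataChartExt_of_lt (hRval y₂)] at h3
    exact Subtype.ext h3
  -- (ii) spacelike immersion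
  have hsp : (Kerr.smoothMetric 0 0 0).IsSpacelikeImmersion 𝓘(ℝ, E3) ψ := by
    refine ⟨hψs, fun y v hv ↦ ?_⟩
    rw [PseudoRiemannianMetric.inducedBilin_apply]
    change 0 < Kerr.bilin 0 0 (ψ y : E4) (mfderiv 𝓘(ℝ, E3) 𝓘(ℝ, E4) ψ y v)
      (mfderiv 𝓘(ℝ, E3) 𝓘(ℝ, E4) ψ y v)
    rw [hmetric]
    exact D.h.pos (φ y) _ fun h ↦ hv (hdφ_inj y v h)
  -- (iii) future unit normal
  have hνψ : (Kerr.smoothMetric 0 0 0).IsFutureUnitNormal 𝓘(ℝ, E3)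
      ((Kerr.timeOrientation 0 0 0 le_rfl).ofLE le_top) ψ fun y ↦ ν (φ y) := by
    refine ⟨⟨fun y v ↦ ?_, fun y ↦ ?_⟩, fun y ↦ ?_⟩
    · change Kerr.bilin 0 0 (ψ y : E4) (ν (φ y)) (mfderiv 𝓘(ℝ, E3) 𝓘(ℝ, E4) ψ y v) = 0
      rw [Kerr.bilin_zero_left, hdψ]
      exact hν.1.1 (φ y) (mfderiv 𝓘(ℝ, E3) (𝓡 3) φ y v)
    · change Kerr.bilin 0 0 (ψ y : E4) (ν (φ y)) (ν (φ y)) = -1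
      rw [Kerr.bilin_zero_left]
      exact hν.1.2 (φ y)
    · obtain ⟨⟨hle, hne⟩, hneg⟩ := hν.2 (φ y)
      refine ⟨⟨?_, hne⟩, ?_⟩
      · change Kerr.bilin 0 0 (ψ y : E4) (ν (φ y)) (ν (φ y)) ≤ 0
        rw [Kerr.bilin_zero_left]
        exact hle
      · change Kerr.bilin 0 0 (ψ y : E4) (Kerr.timeVector 0 0 (ψ y : E4)) (ν (φ y)) < 0
        rw [Kerr.bilin_zero_left, kerr_timeVector_zero_mass]
        exact hneg
  -- (iv) the chart components of `h` are the induced metric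
  have hclause_h : ∀ (y : exteriorRegion ρ) (v w : E3),
      AFEnd.hCoeff e D (y : E3) v w =
        Kerr.bilin 0 0 (ψ y : E4) (mfderiv 𝓘(ℝ, E3) 𝓘(ℝ, E4) ψ y v)
          (mfderiv 𝓘(ℝ, E3) 𝓘(ℝ, E4) ψ y w) := by
    intro y v w
    rw [e.hCoeff_apply_eq_dataChartExt D (hRval y), hmetric, hderiv]
    rfl
  -- (v) the chart components of `k` are the future second fundamental form of the leaf
  have hclause_k : ∀ [(Kerr.smoothMetric 0 0 0).HasLeviCivita] (y : exteriorRegion ρ) (v w : E3),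
      AFEnd.kCoeff e D (y : E3) v w =
        (Kerr.smoothMetric 0 0 0).secondFundamentalForm 𝓘(ℝ, E3) ψ (fun y ↦ ν (φ y)) y v w :=
      by
    intro instK y v w
    haveI instη :
        (Minkowski.metric.ofLE (n' := ∞) le_top).toPseudoRiemannianMetric.HasLeviCivita :=
      (Minkowski.metric.ofLE (n' := ∞) le_top).toPseudoRiemannianMetric.hasLeviCivita
    -- the `M = 0` chart metric is the pullback of `η` along the inclusion
    set gc := (Minkowski.metric.ofLE (n' := ∞) le_top).toPseudoRiemannianMetric.comap
      PseudoRiemannianMetric.contMDiff_pullbackBilin_holds (Subtype.val : Kerr.region (0 : ℝ) 0 → E4)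
      contMDiff_subtype_val
      (injective_mfderiv_subtypeVal (Kerr.region (0 : ℝ) 0)) rfl with hgc_def
    haveI instgc : gc.HasLeviCivita := gc.hasLeviCivita
    have hgc : (Kerr.smoothMetric 0 0 0).toPseudoRiemannianMetric = gc :=
      kerrSmoothMetric_zero_eq_comap 0 0
    -- the normal along `ψ` is differentiable (as a map into `T(Kerr.region 0 0)`)
    have hνψd : MDifferentiableAt 𝓘(ℝ, E3) 𝓘(ℝ, E4).tangent
        (fun y' ↦ (TotalSpace.mk' E4 (ψ y') (ν (φ y')) :
          TangentBundle 𝓘(ℝ, E4) (Kerr.region (0 : ℝ) 0))) y :=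
      (mdifferentiableAt_totalSpace_opens_iff (Kerr.region (0 : ℝ) 0)).2
        ((hνd (φ y)).comp y (hφd y))
    have key := PseudoRiemannianMetric.secondFundamentalForm_comap
      (Minkowski.metric.ofLE (n' := ∞) le_top).toPseudoRiemannianMetric
      PseudoRiemannianMetric.contMDiff_pullbackBilin_holds
      (Φ := (Subtype.val : Kerr.region (0 : ℝ) 0 → E4)) contMDiff_subtype_val
      (injective_mfderiv_subtypeVal (Kerr.region (0 : ℝ) 0)) rfl (f := ψ)
      (ν := fun y' ↦ ν (φ y')) (y := y) BoundarylessManifold.isInteriorPoint hνψd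
    have hnormal : (fun y' ↦ mfderiv 𝓘(ℝ, E4) 𝓘(ℝ, E4)
        (Subtype.val : Kerr.region (0 : ℝ) 0 → E4) (ψ y') (ν (φ y'))) = fun y' ↦ ν (φ y') := by
      funext y'
      rw [mfderiv_subtypeVal]
      rfl
    have key2 :=
      (Minkowski.metric.ofLE (n' := ∞) le_top).toPseudoRiemannianMetric.secondFundamentalForm_comp_right
        (f := ι) (ν := ν) (Ψ := φ) (u := y) BoundarylessManifold.isInteriorPoint
        BoundarylessManifold.isInteriorPoint (hνd (φ y)) (hφd y) v w
    rw [e.kCoeff_apply_eq_dataChartExt D (hRval y),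
      PseudoRiemannianMetric.secondFundamentalForm_congr_metric hgc instK instgc, key, hnormal,
      hψval, key2, hk (φ y), InitialDataSet.kBilin_apply, hderiv]
    rfl
  exact @hasExactKerrEnd_of_chartExactKerrBeyond X _ _ _ _ _ _ _ e D ρ hsole hρR
    ⟨0, 0, 0, le_rfl, ψ, fun y ↦ ν (φ y), hψinj, hsp, hνψ, hclause_h, hclause_k⟩

/-- **A datum with a Cauchy development which is Minkowski space is Kerr-ended** (on a manifold
with a sole end structure `e`): unbundle the development `(ℝ⁴, η, ∂ₜ, ι, ν)`, use that the future
unit normal of a data embedding is differentiable along it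
(`DataEmbedding.mdifferentiableAt_embed_normal`) and that the Cauchy hypersurface `ι(X)` meets the
time axis exactly once (`exists_forall_spatial_eq_zero_imp_eq`), and apply
`hasExactKerrEnd_of_minkowski_embedding`. [folklore] -/
theorem hasExactKerrEnd_of_cauchyDevelopment_eq_minkowski :
    ∀ (X : Type) [TopologicalSpace X] [ChartedSpace E3 X] [IsManifold (𝓡 3) ∞ X] [T2Space X]
      [SecondCountableTopology X] [ConnectedSpace X] (D : InitialDataSet (𝓡 3) X) (e : AFEnd X),
      e.IsSoleEnd → ∀ 𝒟 : CauchyDevelopment D, 𝒟.toSpacetime = Minkowski.spacetime →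
        D.HasExactKerrEnd := by
  intro X _ _ _ _ _ _ D e hsole 𝒟 h𝒟 _
  obtain ⟨𝒮, hC⟩ := 𝒟
  obtain ⟨S, ι, hι, ν, hν, hh, hk⟩ := 𝒮
  dsimp only at h𝒟 hC
  subst h𝒟
  -- the data embedding, rebuilt, for its API
  let 𝒮' : DataEmbedding D := ⟨Minkowski.spacetime, ι, hι, ν, hν, hh, @hk⟩
  have hνd : ∀ x : X, MDifferentiableAt (𝓡 3) 𝓘(ℝ, E4).tangent
      (fun x ↦ (TotalSpace.mk' E4 (ι x) (ν x) : TangentBundle 𝓘(ℝ, E4) E4)) x := fun x ↦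
    𝒮'.mdifferentiableAt_embed_normal x
  have hιE : Manifold.IsSmoothEmbedding (𝓡 3) 𝓘(ℝ, E4) ∞ ι := hι
  have hkE :
      ∀ [inst : (Minkowski.metric.ofLE (n' := ∞) le_top).toPseudoRiemannianMetric.HasLeviCivita]
        (y : X),
        (Minkowski.metric.ofLE (n' := ∞) le_top).toPseudoRiemannianMetric.secondFundamentalForm
          (𝓡 3) ι ν y = D.kBilin y := by
    intro inst y
    exact @hk inst y
  obtain ⟨x₀, hx₀⟩ := exists_forall_spatial_eq_zero_imp_eq ι hιE.isEmbedding.injective hC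
  exact hasExactKerrEnd_of_minkowski_embedding X D e hsole ι hιE ν hν hh hkE hνd x₀ hx₀

end Summit.FinalStateConjecture.FinalStateConjecture.Theorems.ExactKerrEnds

end
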